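import Literature.MathematicalPhysics.QuantumFieldTheory.Balaban1983to89.B9Thm31FlatPoincareCoerciveZd

/-!
# `Balaban1983to89.B9Thm31LevelPoincareCoerciveZd` — [Balaban1984PropagatorsII] (2.22), (2.26)–(2.27) ∕ [Balaban1985BackgroundPropagators] Thm 3.1 p. 397, (3.24) p. 394:
# THE LEVEL-WEIGHTED FLAT COERCIVITY OF `Ω₀Δ′_a(1)Ω₀` AT THE `ℤᵈ` CARRIER — on every block of level `j` the mass is the SMALLER of the Poincaré scale and the
# penalty scale, `m_j = min{8(ηLʲ)⁻², a_j(Lᵈ)^{−j}}`, with NO floor `ηLʲ ≤ 1` and NO lower bound on the weights: per block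
# `m_j·Σ_{Bʲ(y)}|f|²_τ ≤ η⁻²Σ_{internal bonds}|δf|²_τ + a_j|(Q′_j(1)f)(y)|²_τ`, and over a full block geometry covering `Ω₀`
# ★★★ `Σ_{z∈Ω₀} M(z)|f(z)|²_τ ≤ ⟨f, Ω₀Δ′_a(1)Ω₀f⟩_τ` for every site mass `M ≤ m_j` on the level-`j` blocks — the `hco` (c₀ = 1) of this seat's Agmon files WITH PRINT'S LEVEL MASSES

statement-level skeleton of published theorems with citation tags; proofs where landed; nothing here is a claim about the
Yang–Mills mass gap

`[Balaban1984PropagatorsII]` ("[4]∕[B6]", CMP **96** (1984) 223–250) p. 226 *«the operator Δ_a is bounded from below by a positive constant»*, (2.26)–(2.27) p. 235 (the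
block inequality); `[Balaban1985BackgroundPropagators]` ("B9", CMP **99** (1985) 389–434) Thm 3.1 p. 397 (*«uniformly in U, Ω_j»*, the level factors `(Lʲη)²`), (3.24) p. 394
(`a_j(Lʲη)^{d−2}`).  dag-n06-w4 g5's `B9Thm31FlatPoincareCoerciveZd` proves the block inequality (2.27) for `𝔸`-valued fields (`block227_zd_fnorm`) and reads it with a FLAT
mass `a₀ ≤ 8` under the floor `ηLʲ ≤ 1` and `a₀(Lʲ)ᵈ ≤ a_jη²(Lʲ)²`.  THIS FILE reads the SAME block inequality at each block's OWN scale: with `a′ := a_j(ηLʲ)²(Lᵈ)^{−j}` in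
(2.27) and the factor `(ηLʲ)⁻²`, the block mass is `min{8(ηLʲ)⁻², a_j(Lᵈ)^{−j}}` — print's level mass `(Lʲη)⁻²` (Thm 3.1's `(Lʲη)²`) when the weights carry print's scaling
`a_j = a(Lᵈ)ʲ(Lʲη)⁻²`, with no hypothesis relating `a_j` to `η`.  The assembly over the block partition is dag-n06-w4 g5's §5 argument VERBATIM with a site-dependent mass
on the left (credit theirs); the cube-member edition uses their `cover_cubeLamS` and `B9Eq319QQStarDiagonalZd.fullBlockGeometry_cubeMember`.  PURPOSE: this is the displayed
`hco : c₀Σ_zM_z|Φ z|²_τ ≤ ⟨Φ, Ω₀Δ′_aΩ₀Φ⟩_τ` of this seat's `B9Thm31GpAgmonDecayZd ∕ …CoarseZd` at `U₀ = 1` with LEVEL masses, under which the Agmon window is free of the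
lattice spacing at EVERY level of a multi-level member (a flat mass dominates the averaging defect only on members with bounded penalty scales).

CITATION HEADER (lean-in-tree rule).  Cell `pub-ymgap` (YM Track A, HUMAN RULING D-0062 ∕ D-0149 width push), DAG node N06 = [B9], width seat
`pub-ymgap-dag-n06-w2` (g5), CLAIM-5 (offered first to dag-n06-w4 g5, the coercivity lane, OFFER-1 on the bus).  Inputs BY NAME: dag-n06-w4 g5's `block227_zd_fnorm ∕
QprimeIter_one_eq_blockSum ∕ fnorm_covDerivFwd_one_sq ∕ cover_cubeLamS` (`B9Thm31FlatPoincareCoerciveZd`) and `FullBlockGeometry ∕ fullBlockGeometry_cubeMember ∕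
mem_blockSites_pow_iff` (`B9Eq319QQStarDiagonalZd`), dag-n06-w4 g2's `formE_deltaPrimeADom ∕ deltaPrimeADom`, the engine's `fnorm ∕ formE_self_eq_sum_sq`.  Nothing restated.

WHAT IS PROVED (kernel, 0 sorry, 0 def; no `instance`, no `notation`).
* §1 ★★ `block_coercive_level` — ONE BLOCK AT ITS OWN SCALE: `min{8((ηLʲ)²)⁻¹, a_j((Lᵈ)⁻¹)ʲ}·Σ_{x∈Bʲ(y)}|f x|²_τ ≤ (η²)⁻¹Σ_μΣ_{x,x+e_μ∈Bʲ(y)}|f x − f(x+e_μ)|²_τ +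
  a_j|(Q′_j(1)f)(y)|²_τ` (`η > 0`, `a_j ≥ 0`, `L ≥ 1`; no other hypothesis).
* §2 ★★★ `sum_mass_le_formE_deltaPrimeADom_one` — THE LEVEL-WEIGHTED FLAT COERCIVITY: `FullBlockGeometry L m Λ s`, the blocks cover `Ω₀`, `a ≥ 0`, and a site mass `M`
  with `M(x) ≤ min{8((ηLʲ)²)⁻¹, a_j((Lᵈ)⁻¹)ʲ}` whenever `blockMap^[j] x = y ∈ Λ_j` (`j ≤ m`) ⟹ `Σ_{z∈Ω₀} M(z)|f(z)|²_τ ≤ ⟨f, Ω₀Δ′_a(1)Ω₀f⟩_τ` for every `f ∈ L²(Ω₀, ·)`.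
* §3 ★★★ `sum_mass_le_formE_deltaPrimeADom_one_cubeMember` — the same at every cube member of [Balaban1985RegularSpaces] (1.131) (`Λ_j = cubeLamS … m j`, `s = □₀`,
  `L ≤ ρ`, `m ≤ i.k`), NO geometric hypothesis left.

HONEST SCOPE.  (i) FLAT background `U₀ = 1` only (the curved class is dag-n06-w4's near-flat comparison road, `B9Eq324NearFlatFormComparisonZd` ∕ CLAIM-7); (ii) the mass
is DOMINATED (`M ≤ m_j`), so the consumer chooses `M` — for print's weights `a(Lᵈ)ʲ(Lʲη)⁻²` one may take `M = min{8, a}(Lʲη)⁻²` on the level-`j` blocks; (iii) `L²_τ` currency,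
no decay (the decay is this seat's `B9Thm31GpAgmonDecayCoarseZd`).  Count-neutral; N05 ∕ N06 NOT discharged; K1⁹ `stmt-QuantumFields-27364` NOT closed; one finite `𝕋⁴`
programme at fixed `ε`, Bałaban as printed; R4 closes only the conditional finite-`𝕋⁴` rung `BalabanLadder.UV` — nothing continuum ∕ ℝ⁴ ∕ OS ∕ mass gap ∕ Clay.
Unit `pub-ymgap-dag-n06-w2` (g5), 2026-08-28.
-/

noncomputable section

open scoped BigOperators

namespace Literature.MathematicalPhysics.QuantumFieldTheory.Balaban1983to89.B9Thm31LevelPoincareCoerciveZd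

open B7Prop1Explicit
open Literature.MathematicalPhysics.QuantumLattice (blockMap blockSites mem_blockSites_iff card_blockSites)
open B9Eq342CombesThomasFormZd (fnorm fnorm_nonneg fnorm_sq fnorm_smul fnorm_zero formE_self_eq_sum_sq)
open B8Eq131CubesAdmissible (cubeFam)
open B8CubeMemberZd (cubeLamS)
open B8LeafModelZd (ZdIdx)
open B8Eq191FlatLettersCubeMember (cubeLamS_finite)
open B9Thm311PosDefOpenZd (cubeMember_Ω0_finite)
open B9Eq319QQStarDiagonalZd (mem_blockSites_pow_iff FullBlockGeometry fullBlockGeometry_cubeMember)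
open B7Eq78Linearization (QprimeIter zdBlocking)
open B7Prop2Explicit (unitaryUnits)
open B8Ineq132 (covDerivFwd)
open B8Eq119TwistedAxial (bgT)
open B9Eq321LandauProjectionZd (suppSub formE formE_apply)
open B9Eq324DeltaPrimeAZd (deltaPrimeADom formE_deltaPrimeADom)
open B9Eq325QprimeSingleSiteZd (blockMapIter)
open B9Thm31FlatPoincareCoerciveZd (block227_zd_fnorm QprimeIter_one_eq_blockSum fnorm_covDerivFwd_one_sq cover_cubeLamS)

export B7Prop1Explicit (Site)

variable {d : ℕ} {𝔸 : Type*} [CStarAlgebra 𝔸]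
variable (τ : 𝔸 →ₗ[ℂ] ℂ) (hτp : ∀ a : 𝔸, a ≠ 0 → 0 < (τ (star a * a)).re)
  (hτt : ∀ a b : 𝔸, τ (a * b) = τ (b * a)) (hτs : ∀ a : 𝔸, τ (star a) = starRingEnd ℂ (τ a))

/-! ## §1  One block at its own scale -/

section OneBlock

variable [FiniteDimensional ℝ 𝔸] {L : ℕ} [NeZero L] {η : ℝ} {s : Finset (Site d)}

include hτp hτs in
/-- ★★ **ONE BLOCK AT ITS OWN SCALE** ([Balaban1984PropagatorsII] (2.26)–(2.27) × `(Lʲη)⁻²`, with `a′ = a_j(ηLʲ)²(Lᵈ)^{−j}`): for `η > 0`, `a_j ≥ 0`, every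
`f ∈ L²(Ω₀, ·)`, on the block `Bʲ(y)`:
`min{8((ηLʲ)²)⁻¹, a_j((Lᵈ)⁻¹)ʲ}·Σ_{x∈Bʲ(y)}|f x|²_τ ≤ (η²)⁻¹·Σ_μΣ_{x, x+e_μ ∈ Bʲ(y)}|f x − f(x+e_μ)|²_τ + a_j·|(Q′_j(1)f)(y)|²_τ` — NO floor `ηLʲ ≤ 1`, NO relation
between `a_j` and `η`. [cite: Balaban1984PropagatorsII, (2.26)–(2.27) p.235, (2.22) p.226; Balaban1985BackgroundPropagators, Thm 3.1 p.397, (3.24) p.394; Balaban1983RegularityDecay, (2.27) p.580] -/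
theorem block_coercive_level (hη : 0 < η) (j : ℕ) {aj : ℝ} (haj : 0 ≤ aj) (y : Site d) (f : suppSub (𝔸 := 𝔸) s) :
    min (8 * ((η * (L : ℝ) ^ j) ^ 2)⁻¹) (aj * (((L : ℝ) ^ d)⁻¹) ^ j) * ∑ x ∈ blockSites (L ^ j) y, fnorm τ ((f : Site d → 𝔸) x) ^ 2
      ≤ (η ^ 2)⁻¹ * ∑ μ : Fin d, ∑ x ∈ (blockSites (L ^ j) y).filter (fun x => x + e μ ∈ blockSites (L ^ j) y),
            fnorm τ ((f : Site d → 𝔸) x - (f : Site d → 𝔸) (x + e μ)) ^ 2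
        + aj * fnorm τ (QprimeIter (zdBlocking d L) (bgT L (1 : Site d → Fin d → 𝔸ˣ)) j (f : Site d → 𝔸) y) ^ 2 := by
  classical
  have hL0 : (0 : ℝ) < (L : ℝ) := by exact_mod_cast Nat.pos_of_ne_zero (NeZero.ne L)
  set N : ℝ := (L : ℝ) ^ j with hNdef
  have hN : 0 < N := by positivity
  set D : ℝ := N ^ d with hDdef
  have hD : 0 < D := by positivity
  have hη2 : 0 < η ^ 2 := by positivity
  -- the block as `{x : blockMap (n+1) x = y}` with `n + 1 = Lʲ`
  have hNsucc : L ^ j - 1 + 1 = L ^ j := Nat.sub_add_cancel (Nat.one_le_pow _ _ (Nat.pos_of_ne_zero (NeZero.ne L)))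
  haveI : NeZero (L ^ j) := ⟨pow_ne_zero j (NeZero.ne L)⟩
  have hB : ∀ x : Site d, x ∈ blockSites (L ^ j) y ↔ blockMap (L ^ j - 1 + 1) x = y := by
    intro x
    rw [hNsucc]
    exact mem_blockSites_iff (L ^ j) y x
  have hcast : ((L ^ j - 1 : ℕ) : ℝ) + 1 = N := by
    have h1 : ((L ^ j - 1 : ℕ) : ℝ) + 1 = ((L ^ j - 1 + 1 : ℕ) : ℝ) := by push_cast; ring
    rw [h1, hNsucc]
    push_cast
    rfl
  -- the scaled weight `a′ = a_j (ηN)² D⁻¹`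
  set a' : ℝ := aj * η ^ 2 * N ^ 2 * D⁻¹ with ha'def
  have ha'0 : 0 ≤ a' := by positivity
  have h227 := block227_zd_fnorm τ hτp hτs (L ^ j - 1) y (blockSites (L ^ j) y) hB a' (f : Site d → 𝔸)
  rw [hcast] at h227
  -- abbreviations
  set S0 := ∑ x ∈ blockSites (L ^ j) y, fnorm τ ((f : Site d → 𝔸) x) ^ 2 with hS0
  set S1 := ∑ μ : Fin d, ∑ x ∈ (blockSites (L ^ j) y).filter (fun x => x + e μ ∈ blockSites (L ^ j) y),
    fnorm τ ((f : Site d → 𝔸) x - (f : Site d → 𝔸) (x + e μ)) ^ 2 with hS1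
  set S2 := fnorm τ (∑ x ∈ blockSites (L ^ j) y, (f : Site d → 𝔸) x) ^ 2 with hS2
  have hS0nn : 0 ≤ S0 := Finset.sum_nonneg fun _ _ => sq_nonneg _
  -- the averaging term: `|Q′_j(1) f (y)|² = D⁻² · S2`
  have hQ : fnorm τ (QprimeIter (zdBlocking d L) (bgT L (1 : Site d → Fin d → 𝔸ˣ)) j (f : Site d → 𝔸) y) ^ 2 = (D⁻¹) ^ 2 * S2 := by
    rw [QprimeIter_one_eq_blockSum, fnorm_smul, mul_pow, sq_abs, hS2, hDdef, hNdef]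
    congr 1
    rw [inv_pow, ← pow_mul, ← pow_mul, mul_comm]
  -- scale (2.27) by `c = (η²N²)⁻¹ > 0` (no `c ≥ 1` needed)
  set c : ℝ := (η ^ 2)⁻¹ * (N ^ 2)⁻¹ with hcdef
  have hc0 : 0 < c := by positivity
  have hscaled : min 8 a' * c * S0 ≤ (η ^ 2)⁻¹ * S1 + aj * ((D⁻¹) ^ 2 * S2) := by
    have h := mul_le_mul_of_nonneg_left h227 hc0.le
    have e1 : c * (min 8 a' * S0) = min 8 a' * c * S0 := by ring
    have e2 : c * (N ^ 2 * S1 + a' * D⁻¹ * S2) = (η ^ 2)⁻¹ * S1 + aj * ((D⁻¹) ^ 2 * S2) := by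
      rw [hcdef, ha'def]
      field_simp
    rw [e1, e2] at h
    exact h
  -- `min 8 a′ · c = min{8c, a′c} = min{8(ηN)⁻², a_j D⁻¹}`
  have hmin : min (8 * ((η * (L : ℝ) ^ j) ^ 2)⁻¹) (aj * (((L : ℝ) ^ d)⁻¹) ^ j) = min 8 a' * c := by
    rw [min_mul_of_nonneg _ _ hc0.le]
    congr 1
    · rw [hcdef, hNdef, mul_pow, mul_inv]
    · rw [ha'def, hcdef, hDdef, hNdef]
      have hpow : (((L : ℝ) ^ d)⁻¹) ^ j = (((L : ℝ) ^ j) ^ d)⁻¹ := by rw [inv_pow, ← pow_mul, ← pow_mul, mul_comm]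
      have hne : η ^ 2 * ((L : ℝ) ^ j) ^ 2 ≠ 0 := by positivity
      calc aj * (((L : ℝ) ^ d)⁻¹) ^ j
          = aj * (((L : ℝ) ^ j) ^ d)⁻¹ * ((η ^ 2 * ((L : ℝ) ^ j) ^ 2) * (η ^ 2 * ((L : ℝ) ^ j) ^ 2)⁻¹) := by
            rw [mul_inv_cancel₀ hne, mul_one, hpow]
        _ = aj * η ^ 2 * ((L : ℝ) ^ j) ^ 2 * (((L : ℝ) ^ j) ^ d)⁻¹ * ((η ^ 2)⁻¹ * (((L : ℝ) ^ j) ^ 2)⁻¹) := by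
            rw [mul_inv]; ring
  rw [hmin]
  calc min 8 a' * c * S0 ≤ (η ^ 2)⁻¹ * S1 + aj * ((D⁻¹) ^ 2 * S2) := hscaled
    _ = (η ^ 2)⁻¹ * S1 + aj * fnorm τ (QprimeIter (zdBlocking d L) (bgT L (1 : Site d → Fin d → 𝔸ˣ)) j (f : Site d → 𝔸) y) ^ 2 := by
        rw [hQ]

end OneBlock

/-! ## §2  Assembly over the block partition: the level-weighted flat coercivity -/

section Assembly

variable [FiniteDimensional ℝ 𝔸] {L : ℕ} [NeZero L] {η : ℝ}

include hτt hτs in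
/-- ★★★ **THE LEVEL-WEIGHTED FLAT COERCIVITY OF `Ω₀Δ′_a(1)Ω₀`** ([Balaban1984PropagatorsII] (2.22) ∕ [Balaban1985BackgroundPropagators] Thm 3.1's positivity at `U₀ = 1`, each
block at its own scale): if the level blocks of the constraint points lie in `Ω₀` and are pairwise disjoint (`FullBlockGeometry`), COVER `Ω₀`, `a ≥ 0`, `η > 0`, and the site
mass `M` is dominated blockwise, `M(x) ≤ min{8((ηLʲ)²)⁻¹, a_j((Lᵈ)⁻¹)ʲ}` whenever `blockMap^[j] x = y ∈ Λ_j` (`j ≤ m`), then for every `f ∈ L²(Ω₀, ·)`: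
`Σ_{z∈Ω₀} M(z)·|f(z)|²_τ ≤ ⟨f, Ω₀Δ′_a(1)Ω₀f⟩_τ`.  (dag-n06-w4 g5's assembly argument verbatim with a site-dependent left side.)
[cite: Balaban1984PropagatorsII, (2.22) p.226, (2.26)–(2.27) p.235; Balaban1985BackgroundPropagators, Thm 3.1 p.397, (3.23)–(3.24) p.394, Thm 3.11 p.416] -/
theorem sum_mass_le_formE_deltaPrimeADom_one (hη : 0 < η) (m : ℕ) {a : ℕ → ℝ} (ha : ∀ j, 0 ≤ a j)
    (Λ : ℕ → Finset (Site d)) {s : Finset (Site d)}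
    (hG : FullBlockGeometry L m Λ s) (hcov : ∀ x ∈ s, ∃ j ∈ Finset.range (m + 1), blockMapIter L j x ∈ Λ j)
    {M : Site d → ℝ}
    (hM : ∀ j ∈ Finset.range (m + 1), ∀ y ∈ Λ j, ∀ x : Site d, blockMapIter L j x = y →
      M x ≤ min (8 * ((η * (L : ℝ) ^ j) ^ 2)⁻¹) (a j * (((L : ℝ) ^ d)⁻¹) ^ j))
    (f : suppSub (𝔸 := 𝔸) s) :
    ∑ z ∈ s, M z * fnorm τ ((f : Site d → 𝔸) z) ^ 2 ≤ formE τ s f (deltaPrimeADom L (1 : Site d → Fin d → 𝔸ˣ) η τ hτp m a Λ s f) := by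
  classical
  set F : Site d → 𝔸 := (f : Site d → 𝔸) with hF
  -- the constraint set `𝔅` and the blocks
  set B : Finset (ℕ × Site d) := (Finset.range (m + 1)).biUnion fun j => (Λ j).image (Prod.mk j) with hB
  have hmemB : ∀ p : ℕ × Site d, p ∈ B ↔ p.1 ∈ Finset.range (m + 1) ∧ p.2 ∈ Λ p.1 := by
    intro p
    simp only [hB, Finset.mem_biUnion, Finset.mem_image]
    constructor
    · rintro ⟨j, hj, y, hy, rfl⟩
      exact ⟨hj, hy⟩
    · rintro ⟨hj, hy⟩
      exact ⟨p.1, hj, p.2, hy, rfl⟩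
  let blk : ℕ × Site d → Finset (Site d) := fun p => blockSites (L ^ p.1) p.2
  have hblk : ∀ (p : ℕ × Site d) (x : Site d), x ∈ blk p ↔ blockMapIter L p.1 x = p.2 := fun p x => mem_blockSites_pow_iff p.1 p.2 x
  have hdisj : (↑B : Set (ℕ × Site d)).PairwiseDisjoint blk := by
    intro p hp q hq hne
    rw [Finset.mem_coe, hmemB] at hp hq
    rw [Function.onFun, Finset.disjoint_left]
    intro x hxp hxq
    rw [hblk] at hxp hxq
    have hne' : (q.1, q.2) ≠ (p.1, p.2) := fun h' => hne (Prod.ext (Prod.ext_iff.1 h').1.symm (Prod.ext_iff.1 h').2.symm)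
    exact (hG p.1 hp.1 p.2 hp.2).2 q.1 hq.1 q.2 hq.2 hne' x hxp hxq
  -- `Ω₀` IS the disjoint union of the blocks
  have hcover : s = B.biUnion blk := by
    refine Finset.Subset.antisymm (fun x hx => ?_) (fun x hx => ?_)
    · obtain ⟨j, hj, hy⟩ := hcov x hx
      rw [Finset.mem_biUnion]
      exact ⟨(j, blockMapIter L j x), (hmemB _).2 ⟨hj, hy⟩, (hblk _ x).2 rfl⟩
    · rw [Finset.mem_biUnion] at hx
      obtain ⟨p, hp, hxp⟩ := hx
      rw [hmemB] at hp
      exact (hG p.1 hp.1 p.2 hp.2).1 x ((hblk p x).1 hxp)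
  -- the level sums over `𝔅`
  have hdisjB : (↑(Finset.range (m + 1)) : Set ℕ).PairwiseDisjoint (fun j => (Λ j).image (Prod.mk j)) := by
    intro j₁ _ j₂ _ hne
    rw [Function.onFun, Finset.disjoint_left]
    intro p hp₁ hp₂
    rw [Finset.mem_image] at hp₁ hp₂
    obtain ⟨y₁, _, rfl⟩ := hp₁
    obtain ⟨y₂, _, h2⟩ := hp₂
    exact hne (Prod.ext_iff.1 h2).1.symm
  have hlevel : ∀ G : ℕ × Site d → ℝ, ∑ j ∈ Finset.range (m + 1), ∑ y ∈ Λ j, G (j, y) = ∑ p ∈ B, G p := by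
    intro G
    rw [hB, Finset.sum_biUnion hdisjB]
    refine Finset.sum_congr rfl fun j _ => ?_
    rw [Finset.sum_image fun y _ y' _ h' => (Prod.ext_iff.1 h').2]
  -- (i) the left side, block by block, and the blockwise domination of the mass
  have hL' : ∑ z ∈ s, M z * fnorm τ (F z) ^ 2 = ∑ p ∈ B, ∑ x ∈ blk p, M x * fnorm τ (F x) ^ 2 := by
    rw [Finset.sum_congr hcover (fun _ _ => rfl), Finset.sum_biUnion hdisj]
  have hmass : ∀ p ∈ B, ∑ x ∈ blk p, M x * fnorm τ (F x) ^ 2 ≤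
      min (8 * ((η * (L : ℝ) ^ p.1) ^ 2)⁻¹) (a p.1 * (((L : ℝ) ^ d)⁻¹) ^ p.1) * ∑ x ∈ blk p, fnorm τ (F x) ^ 2 := by
    intro p hp
    rw [hmemB] at hp
    rw [Finset.mul_sum]
    refine Finset.sum_le_sum fun x hx => mul_le_mul_of_nonneg_right (hM p.1 hp.1 p.2 hp.2 x ((hblk p x).1 hx)) (sq_nonneg _)
  -- (ii) the per-block inequality (§1)
  have hblock : ∀ p ∈ B, ∑ x ∈ blk p, M x * fnorm τ (F x) ^ 2 ≤
      (η ^ 2)⁻¹ * ∑ μ : Fin d, ∑ x ∈ (blk p).filter (fun x => x + e μ ∈ blk p), fnorm τ (F x - F (x + e μ)) ^ 2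
        + a p.1 * fnorm τ (QprimeIter (zdBlocking d L) (bgT L (1 : Site d → Fin d → 𝔸ˣ)) p.1 F p.2) ^ 2 := by
    intro p hp
    exact (hmass p hp).trans (block_coercive_level τ hτp hτs hη p.1 (ha p.1) p.2 f)
  -- (iii) the right side: gradient energy + penalty
  have hone : ∀ (x : Site d) (κ : Fin d), (1 : Site d → Fin d → 𝔸ˣ) x κ ∈ unitaryUnits 𝔸 := fun _ _ => (unitaryUnits 𝔸).one_mem
  have hR : formE τ s f (deltaPrimeADom L (1 : Site d → Fin d → 𝔸ˣ) η τ hτp m a Λ s f) =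
      (∑ μ : Fin d, ∑ᶠ x, fnorm τ (covDerivFwd η (1 : Site d → Fin d → 𝔸ˣ) μ F x) ^ 2) +
        ∑ p ∈ B, a p.1 * fnorm τ (QprimeIter (zdBlocking d L) (bgT L (1 : Site d → Fin d → 𝔸ˣ)) p.1 F p.2) ^ 2 := by
    rw [formE_deltaPrimeADom (L := L) (m := m) (a := a) (Λ := Λ) τ hτp hτt hτs hone f f]
    congr 1
    · refine Finset.sum_congr rfl fun μ _ => finsum_congr fun x => ?_
      exact (fnorm_sq hτp _).symm
    · rw [← hlevel (fun p => a p.1 * fnorm τ (QprimeIter (zdBlocking d L) (bgT L (1 : Site d → Fin d → 𝔸ˣ)) p.1 F p.2) ^ 2)]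
      refine Finset.sum_congr rfl fun j _ => ?_
      rw [Finset.mul_sum]
      exact Finset.sum_congr rfl fun y _ => by rw [(fnorm_sq hτp _).symm]
  -- (iv) the gradient energy dominates the internal-bond sums of all blocks
  have hgrad : ∀ μ : Fin d,
      (η ^ 2)⁻¹ * ∑ p ∈ B, ∑ x ∈ (blk p).filter (fun x => x + e μ ∈ blk p), fnorm τ (F x - F (x + e μ)) ^ 2 ≤
        ∑ᶠ x, fnorm τ (covDerivFwd η (1 : Site d → Fin d → 𝔸ˣ) μ F x) ^ 2 := by
    intro μ
    set T : Finset (Site d) := s ∪ s.image (fun z => z - e μ) with hT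
    have hsupp : (Function.support fun x => fnorm τ (covDerivFwd η (1 : Site d → Fin d → 𝔸ˣ) μ F x) ^ 2) ⊆ ↑T := by
      intro x hx
      rw [Function.mem_support] at hx
      by_contra hxT
      rw [hT, Finset.coe_union, Set.mem_union, Finset.mem_coe, Finset.coe_image, Set.mem_image] at hxT
      simp only [not_or, not_exists, not_and] at hxT
      apply hx
      have h1 : F x = 0 := f.2 x hxT.1
      have h2 : F (x + e μ) = 0 := by
        by_contra hne
        have hmem : x + e μ ∈ s := by by_contra hh; exact hne (f.2 _ hh)
        exact hxT.2 (x + e μ) (Finset.mem_coe.2 hmem) (by simp)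
      rw [fnorm_covDerivFwd_one_sq, h1, h2, sub_zero, fnorm_zero]
      ring
    rw [finsum_eq_sum_of_support_subset _ hsupp]
    have hdisjμ : (↑B : Set (ℕ × Site d)).PairwiseDisjoint (fun p => (blk p).filter (fun x => x + e μ ∈ blk p)) := by
      intro p hp q hq hne
      exact Finset.disjoint_filter_filter (hdisj hp hq hne)
    rw [← Finset.sum_biUnion hdisjμ]
    have hsub : B.biUnion (fun p => (blk p).filter (fun x => x + e μ ∈ blk p)) ⊆ T := by
      intro x hx
      rw [Finset.mem_biUnion] at hx
      obtain ⟨p, hp, hxp⟩ := hx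
      rw [Finset.mem_filter] at hxp
      have hxs : x ∈ s := by rw [hcover, Finset.mem_biUnion]; exact ⟨p, hp, hxp.1⟩
      exact Finset.mem_union_left _ hxs
    rw [Finset.mul_sum]
    calc ∑ x ∈ B.biUnion (fun p => (blk p).filter (fun x => x + e μ ∈ blk p)), (η ^ 2)⁻¹ * fnorm τ (F x - F (x + e μ)) ^ 2
        = ∑ x ∈ B.biUnion (fun p => (blk p).filter (fun x => x + e μ ∈ blk p)), fnorm τ (covDerivFwd η (1 : Site d → Fin d → 𝔸ˣ) μ F x) ^ 2 :=
          Finset.sum_congr rfl fun x _ => (fnorm_covDerivFwd_one_sq τ η μ F x).symm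
      _ ≤ ∑ x ∈ T, fnorm τ (covDerivFwd η (1 : Site d → Fin d → 𝔸ˣ) μ F x) ^ 2 :=
          Finset.sum_le_sum_of_subset_of_nonneg hsub fun _ _ _ => sq_nonneg _
  -- (v) assemble
  rw [hL', hR]
  calc ∑ p ∈ B, ∑ x ∈ blk p, M x * fnorm τ (F x) ^ 2
      ≤ ∑ p ∈ B, ((η ^ 2)⁻¹ * ∑ μ : Fin d, ∑ x ∈ (blk p).filter (fun x => x + e μ ∈ blk p), fnorm τ (F x - F (x + e μ)) ^ 2
          + a p.1 * fnorm τ (QprimeIter (zdBlocking d L) (bgT L (1 : Site d → Fin d → 𝔸ˣ)) p.1 F p.2) ^ 2) := Finset.sum_le_sum hblock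
    _ = (∑ μ : Fin d, (η ^ 2)⁻¹ * ∑ p ∈ B, ∑ x ∈ (blk p).filter (fun x => x + e μ ∈ blk p), fnorm τ (F x - F (x + e μ)) ^ 2) +
          ∑ p ∈ B, a p.1 * fnorm τ (QprimeIter (zdBlocking d L) (bgT L (1 : Site d → Fin d → 𝔸ˣ)) p.1 F p.2) ^ 2 := by
        rw [Finset.sum_add_distrib]
        congr 1
        rw [← Finset.mul_sum, ← Finset.mul_sum, Finset.sum_comm]
    _ ≤ _ := by
        gcongr with μ _
        exact hgrad μ

end Assembly

/-! ## §3  At the cube members of (1.131) -/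

section CubeMember

variable [FiniteDimensional ℝ 𝔸] {L : ℕ} [NeZero L] {η : ℝ}

include hτt hτs in
/-- ★★★ **THE LEVEL-WEIGHTED FLAT COERCIVITY AT EVERY CUBE MEMBER OF (1.131)** (`Λ_j = cubeLamS … m j`, `s = □₀ = i.Ω 0`, `L ≤ ρ`, `m ≤ i.k`): for `η > 0`, `a ≥ 0` and
every site mass dominated blockwise by `min{8((ηLʲ)²)⁻¹, a_j((Lᵈ)⁻¹)ʲ}`: `Σ_{z∈□₀} M(z)|f z|²_τ ≤ ⟨f, □₀Δ′_a(1)□₀ f⟩_τ` — NO geometric hypothesis left.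
[cite: Balaban1984PropagatorsII, (2.22) p.226, (2.26)–(2.27) p.235; Balaban1985BackgroundPropagators, Thm 3.1 p.397, Thm 3.11 p.416; Balaban1985RegularSpaces, (1.131) p.99] -/
theorem sum_mass_le_formE_deltaPrimeADom_one_cubeMember (hη : 0 < η) {a₁ : ℕ → ℝ} (ha : ∀ j, 0 ≤ a₁ j)
    (i : ZdIdx d L) {a : Site d} {Mc ρ : ℕ} (hΩ : i.Ω = cubeFam false L a Mc ρ i.k) (hρ : L ≤ ρ) {m : ℕ} (hm : m ≤ i.k)
    {M : Site d → ℝ}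
    (hM : ∀ j ∈ Finset.range (m + 1), ∀ y ∈ (cubeLamS_finite L a Mc ρ i.k m j).toFinset, ∀ x : Site d, blockMapIter L j x = y →
      M x ≤ min (8 * ((η * (L : ℝ) ^ j) ^ 2)⁻¹) (a₁ j * (((L : ℝ) ^ d)⁻¹) ^ j))
    (f : suppSub (𝔸 := 𝔸) (cubeMember_Ω0_finite i hΩ).toFinset) :
    ∑ z ∈ (cubeMember_Ω0_finite i hΩ).toFinset, M z * fnorm τ ((f : Site d → 𝔸) z) ^ 2 ≤
      formE τ (cubeMember_Ω0_finite i hΩ).toFinset f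
        (deltaPrimeADom L (1 : Site d → Fin d → 𝔸ˣ) η τ hτp m a₁ (fun j => (cubeLamS_finite L a Mc ρ i.k m j).toFinset)
          (cubeMember_Ω0_finite i hΩ).toFinset f) := by
  have hL1 : 1 ≤ L := Nat.one_le_iff_ne_zero.2 (NeZero.ne L)
  have hs : ∀ x, x ∈ (cubeMember_Ω0_finite i hΩ).toFinset ↔ x ∈ cubeFam false L a Mc ρ i.k 0 := by
    intro x
    rw [Set.Finite.mem_toFinset, hΩ]
  have hΛ : ∀ j y, y ∈ (cubeLamS_finite L a Mc ρ i.k m j).toFinset ↔ y ∈ cubeLamS L a Mc ρ i.k m j :=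
    fun j y => Set.Finite.mem_toFinset _
  refine sum_mass_le_formE_deltaPrimeADom_one τ hτp hτt hτs hη m ha _ (fullBlockGeometry_cubeMember i hΩ hρ hm) (fun x hx => ?_) hM f
  obtain ⟨j, hj, hmem⟩ := cover_cubeLamS hL1 a Mc ρ ((hs x).1 hx)
  exact ⟨j, hj, (hΛ j _).2 hmem⟩

end CubeMember

end Literature.MathematicalPhysics.QuantumFieldTheory.Balaban1983to89.B9Thm31LevelPoincareCoerciveZd

end
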